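import Summits.NavierStokesRegularity.FunctionalMining.NoGo.TopEigStrainMixRateGammaTwo
import Summits.NavierStokesRegularity.FunctionalMining.TopEigGapCoerciveSimpleAux
import Literature.Analysis.FluidPDE.TorusNSChessboardTimeAverages
import HarnessLib

/-!
# FunctionalMining — L-λ(η) for `2 < q ≤ 6`, the velocity side: `∫ S:N = −∫ u·div N`, and the
# Sobolev–Hölder brick `∫ ‖u‖² λ₁^{q−2} ≤ 72·C₆^{1/3}·Φ_q`

Search for candidate a priori estimates; no regularity claim. Cell `pub-nsfunc`, prove seat
(gen 26). Toward the dictionary's node `TopEigGapCoercivePos q η` for `2 < q ≤ 6` (the no-go seat's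
Proposition L-λ(η), SIEVELD §3.4b (4): "`M_q = λ₁^{q−2}M`, Hölder `2/q + (q−2)/q = 1` and
`‖u‖_q ≲ ‖∇u‖₂` for `q ≤ 6`"). The `q = 2` moment side used `∫S = 0`; for `q > 2` the mean of
`M_q = H(λ₁)·P₁` is removed by integrating by parts against the velocity itself:

* `sum_strain_mul_symm_eq` / **`integral_sum_strain_mul_eq_neg`** — for `u` smooth and a smooth symmetric
  matrix field `N`: `∫ ∑ᵢⱼ Sᵢⱼ(u) Nᵢⱼ = −∫ ∑ⱼ uⱼ ∑ᵢ ∂ᵢNᵢⱼ` (`∫ ∂ᵢa · b = −∫ a · ∂ᵢb` on `T³`);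
* `abs_sum_mul_le_norm_mul_sqrt`, `sum_sq_sum_le_three_mul` — pointwise Cauchy–Schwarz
  `|∑ⱼ uⱼdⱼ| ≤ ‖u‖ (∑ⱼdⱼ²)^{1/2}`, `∑ⱼ(∑ᵢcᵢⱼ)² ≤ 3∑ᵢⱼcᵢⱼ²`;
* **`integral_norm_sq_mul_topEig_rpow_le`** — for `u` smooth, divergence free, zero mean on `T³` and
  `2 < q ≤ 6`: `∫ ‖u‖² λ₁^{q−2} ≤ 72 (C₆+1)^{1/3} Φ_q^{2/q} Φ_q^{(q−2)/q} = 72 (C₆+1)^{1/3} Φ_q`, where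
  `C₆` is the tree's `L⁶` Sobolev constant (`Torus.exists_integral_norm_pow_six_le_gradNormSq_cube`):
  Hölder `(q/2, q/(q−2))`, Jensen `‖u‖_q ≤ ‖u‖₆` (`q ≤ 6`, unit volume), `∫‖u‖⁶ ≤ C₆‖∇u‖₂⁶`,
  `‖∇u‖₂² = 2ℰ ≤ 72 Φ₂` (`torusEnstrophy_le_topEigMoment_two`), Jensen `Φ₂ ≤ Φ_q^{2/q}`.

[ours]
-/

noncomputable section

open Filter Topology Matrix Finset MeasureTheory
open scoped ContDiff

namespace Summit.NavierStokesRegularity.FunctionalMining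

open Literature.Analysis Literature.Analysis.FunctionSpaces Literature.Analysis.FunctionSpaces.Torus
  SharpClass.DirectorForm Literature.Analysis.Matrix Literature.Analysis.FluidPDE

namespace TopEig

variable {v : UnitAddTorus (Fin 3) → EuclideanSpace ℝ (Fin 3)}

/-! ## 1. Integration by parts against the velocity -/

/-- For a symmetric matrix `N`: `∑ᵢⱼ Sᵢⱼ(u)(x) Nᵢⱼ = ∑ᵢⱼ (∂ᵢu)ⱼ(x) Nᵢⱼ`. [ours, bookkeeping] -/
theorem sum_strain_mul_symm_eq (u : UnitAddTorus (Fin 3) → EuclideanSpace ℝ (Fin 3))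
    (x : UnitAddTorus (Fin 3)) {N : Fin 3 → Fin 3 → ℝ} (hsym : ∀ i j, N i j = N j i) :
    ∑ i, ∑ j, torusStrainMatrix u x i j * N i j = ∑ i, ∑ j, Torus.partialDeriv i u x j * N i j := by
  simp only [torusStrainMatrix, Matrix.of_apply, add_div, add_mul, Finset.sum_add_distrib]
  have hswap : ∑ i, ∑ j, Torus.partialDeriv j u x i / 2 * N i j = ∑ i, ∑ j, Torus.partialDeriv i u x j / 2 * N i j := by
    rw [Finset.sum_comm]
    exact Finset.sum_congr rfl fun i _ => Finset.sum_congr rfl fun j _ => by rw [hsym j i]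
  rw [hswap, ← Finset.sum_add_distrib]
  refine Finset.sum_congr rfl fun i _ => ?_
  rw [← Finset.sum_add_distrib]
  exact Finset.sum_congr rfl fun j _ => by ring

/-- **`∫ ∑ᵢⱼ Sᵢⱼ(u) Nᵢⱼ = −∫ ∑ⱼ uⱼ ∑ᵢ ∂ᵢ Nᵢⱼ`** for `u` smooth and `N` a smooth symmetric matrix field on
`T³` (integration by parts entrywise). [ours; folklore] -/
theorem integral_sum_strain_mul_eq_neg (hv : Torus.IsSmooth v)
    {N : Fin 3 → Fin 3 → UnitAddTorus (Fin 3) → ℝ} (hN : ∀ i j, Torus.IsSmooth (N i j))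
    (hsym : ∀ i j x, N i j x = N j i x) :
    ∫ x, ∑ i, ∑ j, torusStrainMatrix v x i j * N i j x =
      -∫ x, ∑ j, v x j * ∑ i, Torus.partialDeriv i (N i j) x := by
  have hvj : ∀ j, Torus.IsSmooth (fun y => v y j) := fun j => hv.apply j
  have hint : ∀ i j, Integrable (fun x => Torus.partialDeriv i (fun y => v y j) x * N i j x) volume :=
    fun i j => (((hvj j).partialDeriv i).continuous.mul (hN i j).continuous).integrable_unitAddTorus
  have hint' : ∀ i j, Integrable (fun x => v x j * Torus.partialDeriv i (N i j) x) volume :=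
    fun i j => ((hvj j).continuous.mul ((hN i j).partialDeriv i).continuous).integrable_unitAddTorus
  have hpt : ∀ x, ∑ i, ∑ j, torusStrainMatrix v x i j * N i j x =
      ∑ i, ∑ j, Torus.partialDeriv i (fun y => v y j) x * N i j x := by
    intro x
    rw [sum_strain_mul_symm_eq v x (fun i j => hsym i j x)]
    refine Finset.sum_congr rfl fun i _ => Finset.sum_congr rfl fun j _ => ?_
    rw [partialDeriv_apply_coord (hv.isContDiff (by simp)) i x j]
  rw [integral_congr_ae (ae_of_all _ hpt),
    integral_finsetSum _ fun i _ => integrable_finsetSum _ fun j _ => hint i j]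
  have hibp : ∀ i j, ∫ x, Torus.partialDeriv i (fun y => v y j) x * N i j x =
      -∫ x, v x j * Torus.partialDeriv i (N i j) x :=
    fun i j => Literature.Analysis.FluidPDE.Torus.integral_partialDeriv_mul_eq_neg_integral (hvj j) (hN i j) i
  have hrhs : ∫ x, ∑ j, v x j * ∑ i, Torus.partialDeriv i (N i j) x =
      ∑ i, ∑ j, ∫ x, v x j * Torus.partialDeriv i (N i j) x := by
    have e : ∀ x, ∑ j, v x j * ∑ i, Torus.partialDeriv i (N i j) x =
        ∑ i, ∑ j, v x j * Torus.partialDeriv i (N i j) x := by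
      intro x
      rw [Finset.sum_comm]
      exact Finset.sum_congr rfl fun j _ => by rw [Finset.mul_sum]
    rw [integral_congr_ae (ae_of_all _ e),
      integral_finsetSum _ fun i _ => integrable_finsetSum _ fun j _ => hint' i j]
    exact Finset.sum_congr rfl fun i _ => integral_finsetSum _ fun j _ => hint' i j
  rw [hrhs, ← Finset.sum_neg_distrib]
  refine Finset.sum_congr rfl fun i _ => ?_
  rw [integral_finsetSum _ fun j _ => hint i j, ← Finset.sum_neg_distrib]
  exact Finset.sum_congr rfl fun j _ => hibp i j

/-! ## 2. Pointwise Cauchy–Schwarz -/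

/-- `|∑ⱼ uⱼ dⱼ| ≤ ‖u‖ · (∑ⱼ dⱼ²)^{1/2}` for `u : ℝ³` (Euclidean norm). [folklore] -/
theorem abs_sum_mul_le_norm_mul_sqrt (u : EuclideanSpace ℝ (Fin 3)) (d : Fin 3 → ℝ) :
    |∑ j, u j * d j| ≤ ‖u‖ * Real.sqrt (∑ j, d j ^ 2) := by
  have h := Finset.sum_mul_sq_le_sq_mul_sq (Finset.univ : Finset (Fin 3)) (fun j => u j) d
  have hn : ‖u‖ = Real.sqrt (∑ j, u j ^ 2) := by
    rw [EuclideanSpace.norm_eq]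
    congr 1
    exact Finset.sum_congr rfl fun j _ => by rw [Real.norm_eq_abs, sq_abs]
  rw [hn, ← Real.sqrt_mul (Finset.sum_nonneg fun j _ => sq_nonneg _)]
  exact Real.abs_le_sqrt h

/-- `∑ⱼ (∑ᵢ cᵢⱼ)² ≤ 3 ∑ᵢⱼ cᵢⱼ²` on `Fin 3`. [folklore] -/
theorem sum_sq_sum_le_three_mul (c : Fin 3 → Fin 3 → ℝ) :
    ∑ j, (∑ i, c i j) ^ 2 ≤ 3 * ∑ i, ∑ j, c i j ^ 2 := by
  have hj : ∀ j, (∑ i, c i j) ^ 2 ≤ 3 * ∑ i, c i j ^ 2 := by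
    intro j
    simp only [Fin.sum_univ_three]
    nlinarith [sq_nonneg (c 0 j - c 1 j), sq_nonneg (c 1 j - c 2 j), sq_nonneg (c 0 j - c 2 j)]
  calc ∑ j, (∑ i, c i j) ^ 2 ≤ ∑ j, 3 * ∑ i, c i j ^ 2 := Finset.sum_le_sum fun j _ => hj j
    _ = 3 * ∑ i, ∑ j, c i j ^ 2 := by rw [← Finset.mul_sum, Finset.sum_comm]

/-! ## 3. The Sobolev–Hölder brick `∫ ‖u‖² λ₁^{q−2} ≤ K · Φ_q` -/

/-- Jensen on the unit torus: `Φ₂ ≤ Φ_q^{2/q}` for `q > 2`, divergence-free `v` (`λ₁ ≥ 0`,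
`Φ_r = ∫ λ₁^r`). [folklore] -/
theorem topEigMoment_two_le_rpow (hv : Torus.IsSmooth v) (hdiv : Torus.IsDivFree v) {q : ℝ} (hq : 2 < q) :
    torusTopEigMoment 2 v ≤ torusTopEigMoment q v ^ (2 / q) := by
  have hl0 : ∀ x, 0 ≤ torusStrainTopEig v x := fun x => by
    rw [← lam_strainFlat]; exact lam_strainFlat_nonneg hv hdiv x
  have hlc : Continuous (torusStrainTopEig v) := continuous_torusStrainTopEig hv
  have hq0 : 0 < q := by linarith
  have hp : (q / 2).HolderConjugate (Real.conjExponent (q / 2)) :=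
    Real.HolderConjugate.conjExponent (by rw [lt_div_iff₀ two_pos]; linarith)
  have hf : MemLp (fun x => torusStrainTopEig v x ^ (2 : ℝ)) (ENNReal.ofReal (q / 2)) volume :=
    (hlc.rpow_const fun x => Or.inr (by norm_num)).memLp_of_hasCompactSupport (HasCompactSupport.of_compactSpace _)
  have hg : MemLp (fun _ : UnitAddTorus (Fin 3) => (1 : ℝ)) (ENNReal.ofReal (Real.conjExponent (q / 2))) volume :=
    continuous_const.memLp_of_hasCompactSupport (HasCompactSupport.of_compactSpace _)
  have hH := integral_mul_le_Lp_mul_Lq_of_nonneg (μ := volume) hp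
    (ae_of_all _ fun x => Real.rpow_nonneg (hl0 x) _) (ae_of_all _ fun _ => zero_le_one) hf hg
  have e1 : ∫ x, torusStrainTopEig v x ^ (2 : ℝ) * (1 : ℝ) = torusTopEigMoment 2 v := by
    rw [torusTopEigMoment_eq hv hdiv 2]
    refine integral_congr_ae (ae_of_all _ fun x => ?_)
    dsimp only
    rw [mul_one, lam_strainFlat]
  have e2 : ∫ x, (torusStrainTopEig v x ^ (2 : ℝ)) ^ (q / 2) = torusTopEigMoment q v := by
    rw [torusTopEigMoment_eq hv hdiv q]
    refine integral_congr_ae (ae_of_all _ fun x => ?_)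
    dsimp only
    rw [← Real.rpow_mul (hl0 x), show (2 : ℝ) * (q / 2) = q by ring, lam_strainFlat]
  have e3 : (∫ x, (1 : ℝ) ^ Real.conjExponent (q / 2) ∂(volume : Measure (UnitAddTorus (Fin 3)))) ^
      (1 / Real.conjExponent (q / 2)) = 1 := by
    simp [Real.one_rpow]
  rw [e1, e2, e3, mul_one, one_div, inv_div] at hH
  exact hH

/-- Jensen on the unit torus: `(∫‖u‖^q)^{2/q} ≤ (∫‖u‖⁶)^{1/3}` for `2 < q ≤ 6` and continuous `u`.
[folklore] -/
theorem rpow_integral_norm_rpow_le {u : UnitAddTorus (Fin 3) → EuclideanSpace ℝ (Fin 3)}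
    (hu : Continuous u) {q : ℝ} (hq : 2 < q) (hq6 : q ≤ 6) :
    (∫ x, ‖u x‖ ^ q) ^ (2 / q) ≤ (∫ x, ‖u x‖ ^ (6 : ℝ)) ^ ((1 : ℝ) / 3) := by
  have hq0 : 0 < q := by linarith
  have hI0 : 0 ≤ ∫ x, ‖u x‖ ^ q := integral_nonneg fun x => Real.rpow_nonneg (norm_nonneg _) _
  have hJ0 : 0 ≤ ∫ x, ‖u x‖ ^ (6 : ℝ) := integral_nonneg fun x => Real.rpow_nonneg (norm_nonneg _) _
  -- first `∫‖u‖^q ≤ (∫‖u‖⁶)^{q/6}`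
  have hmain : ∫ x, ‖u x‖ ^ q ≤ (∫ x, ‖u x‖ ^ (6 : ℝ)) ^ (q / 6) := by
    rcases eq_or_lt_of_le hq6 with h6 | h6
    · subst h6
      rw [show (6 : ℝ) / 6 = 1 by norm_num, Real.rpow_one]
    · have hp : (6 / q).HolderConjugate (Real.conjExponent (6 / q)) :=
        Real.HolderConjugate.conjExponent (by rw [lt_div_iff₀ hq0]; linarith)
      have hf : MemLp (fun x => ‖u x‖ ^ q) (ENNReal.ofReal (6 / q)) volume :=
        (hu.norm.rpow_const fun x => Or.inr hq0.le).memLp_of_hasCompactSupport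
          (HasCompactSupport.of_compactSpace _)
      have hg : MemLp (fun _ : UnitAddTorus (Fin 3) => (1 : ℝ)) (ENNReal.ofReal (Real.conjExponent (6 / q)))
          volume := continuous_const.memLp_of_hasCompactSupport (HasCompactSupport.of_compactSpace _)
      have hH := integral_mul_le_Lp_mul_Lq_of_nonneg (μ := volume) hp
        (ae_of_all _ fun x => Real.rpow_nonneg (norm_nonneg _) _) (ae_of_all _ fun _ => zero_le_one) hf hg
      have e2 : ∫ x, (‖u x‖ ^ q) ^ (6 / q) = ∫ x, ‖u x‖ ^ (6 : ℝ) := by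
        refine integral_congr_ae (ae_of_all _ fun x => ?_)
        dsimp only
        rw [← Real.rpow_mul (norm_nonneg _), show q * (6 / q) = 6 by field_simp]
      have e3 : (∫ x, (1 : ℝ) ^ Real.conjExponent (6 / q) ∂(volume : Measure (UnitAddTorus (Fin 3)))) ^
          (1 / Real.conjExponent (6 / q)) = 1 := by
        simp [Real.one_rpow]
      simp only [mul_one] at hH
      rw [e2, e3, mul_one, one_div, inv_div] at hH
      exact hH
  -- raise to the power `2/q`
  have h2q : 0 ≤ 2 / q := by positivity
  calc (∫ x, ‖u x‖ ^ q) ^ (2 / q) ≤ ((∫ x, ‖u x‖ ^ (6 : ℝ)) ^ (q / 6)) ^ (2 / q) :=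
        Real.rpow_le_rpow hI0 hmain h2q
    _ = (∫ x, ‖u x‖ ^ (6 : ℝ)) ^ ((1 : ℝ) / 3) := by
        rw [← Real.rpow_mul hJ0]
        congr 1
        field_simp
        ring

/-- **THE SOBOLEV–HÖLDER BRICK.** There is `K ≥ 0` (namely `72·(C₆+1)^{1/3}`, `C₆` the tree's `L⁶`
Sobolev constant on `T³`) such that for every smooth, divergence-free, zero-mean `u` on `T³` and every
`2 < q ≤ 6`: `∫ ‖u‖² λ₁^{q−2} ≤ K · Φ_q(u)`. Chain: Hölder `(q/2, q/(q−2))`,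
`(∫‖u‖^q)^{2/q} ≤ (∫‖u‖⁶)^{1/3} ≤ (C₆+1)^{1/3}‖∇u‖₂²`, `‖∇u‖₂² = 2ℰ ≤ 72Φ₂ ≤ 72Φ_q^{2/q}`, and
`Φ_q^{2/q}·Φ_q^{(q−2)/q} = Φ_q`. [ours] -/
theorem exists_integral_norm_sq_mul_topEig_rpow_le :
    ∃ K : ℝ, 0 ≤ K ∧ ∀ (u : UnitAddTorus (Fin 3) → EuclideanSpace ℝ (Fin 3)), Torus.IsSmooth u →
      Torus.IsDivFree u → Torus.HasZeroMean u → ∀ q : ℝ, 2 < q → q ≤ 6 →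
        ∫ x, ‖u x‖ ^ 2 * torusStrainTopEig u x ^ (q - 2) ≤ K * torusTopEigMoment q u := by
  obtain ⟨C₆, hC₆, hSob⟩ := Torus.exists_integral_norm_pow_six_le_gradNormSq_cube (d := Fin 3) (by simp)
  refine ⟨72 * (C₆ + 1) ^ ((1 : ℝ) / 3), by positivity, fun u hu hdiv hmean q hq hq6 => ?_⟩
  have hq0 : 0 < q := by linarith
  have hq2 : 0 < q - 2 := by linarith
  have hl0 : ∀ x, 0 ≤ torusStrainTopEig u x := fun x => by
    rw [← lam_strainFlat]; exact lam_strainFlat_nonneg hu hdiv x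
  have hlc : Continuous (torusStrainTopEig u) := continuous_torusStrainTopEig hu
  have huc : Continuous u := hu.continuous
  have hF0 : 0 ≤ torusTopEigMoment q u := torusTopEigMoment_nonneg q u
  -- Hölder `(q/2, q/(q−2))`
  have hp : (q / 2).HolderConjugate (q / (q - 2)) := by
    rw [Real.holderConjugate_iff]
    refine ⟨by rw [lt_div_iff₀ two_pos]; linarith, ?_⟩
    field_simp
    ring
  have hf : MemLp (fun x => ‖u x‖ ^ 2) (ENNReal.ofReal (q / 2)) volume :=
    (huc.norm.pow 2).memLp_of_hasCompactSupport (HasCompactSupport.of_compactSpace _)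
  have hg : MemLp (fun x => torusStrainTopEig u x ^ (q - 2)) (ENNReal.ofReal (q / (q - 2))) volume :=
    (hlc.rpow_const fun x => Or.inr hq2.le).memLp_of_hasCompactSupport (HasCompactSupport.of_compactSpace _)
  have hH := integral_mul_le_Lp_mul_Lq_of_nonneg (μ := volume) hp
    (ae_of_all _ fun x => sq_nonneg _) (ae_of_all _ fun x => Real.rpow_nonneg (hl0 x) _) hf hg
  have eA : ∫ x, (‖u x‖ ^ 2) ^ (q / 2) = ∫ x, ‖u x‖ ^ q := by
    refine integral_congr_ae (ae_of_all _ fun x => ?_)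
    dsimp only
    rw [← Real.rpow_natCast, ← Real.rpow_mul (norm_nonneg _)]
    congr 1; push_cast; field_simp
  have eB : ∫ x, (torusStrainTopEig u x ^ (q - 2)) ^ (q / (q - 2)) = torusTopEigMoment q u := by
    rw [torusTopEigMoment_eq hu hdiv q]
    refine integral_congr_ae (ae_of_all _ fun x => ?_)
    dsimp only
    rw [← Real.rpow_mul (hl0 x), show (q - 2) * (q / (q - 2)) = q by field_simp, lam_strainFlat]
  rw [eA, eB, one_div, one_div, inv_div, inv_div] at hH
  -- the velocity factor
  have hI0 : 0 ≤ ∫ x, ‖u x‖ ^ q := integral_nonneg fun x => Real.rpow_nonneg (norm_nonneg _) _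
  have hJ : (∫ x, ‖u x‖ ^ q) ^ (2 / q) ≤ (C₆ + 1) ^ ((1 : ℝ) / 3) * (72 * torusTopEigMoment q u ^ (2 / q)) := by
    have h1 := rpow_integral_norm_rpow_le huc hq hq6
    have h6 : ∫ x, ‖u x‖ ^ (6 : ℝ) = ∫ x, ‖u x‖ ^ 6 :=
      integral_congr_ae (ae_of_all _ fun x => by
        dsimp only; rw [show (6 : ℝ) = ((6 : ℕ) : ℝ) by norm_num, Real.rpow_natCast])
    have h2 : ∫ x, ‖u x‖ ^ 6 ≤ (C₆ + 1) * Torus.gradNormSq u ^ 3 := by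
      have := hSob u hu hmean
      have hG0 : 0 ≤ Torus.gradNormSq u ^ 3 := pow_nonneg (Torus.gradNormSq_nonneg u) 3
      nlinarith
    have hG : Torus.gradNormSq u ≤ 72 * torusTopEigMoment q u ^ (2 / q) := by
      rw [gradNormSq_eq_two_mul_torusEnstrophy]
      have h3 := torusEnstrophy_le_topEigMoment_two hu hdiv
      have h4 := topEigMoment_two_le_rpow hu hdiv hq
      linarith
    have hG0 : 0 ≤ Torus.gradNormSq u := Torus.gradNormSq_nonneg u
    have hJ6 : 0 ≤ ∫ x, ‖u x‖ ^ 6 := integral_nonneg fun x => pow_nonneg (norm_nonneg _) 6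
    calc (∫ x, ‖u x‖ ^ q) ^ (2 / q) ≤ (∫ x, ‖u x‖ ^ (6 : ℝ)) ^ ((1 : ℝ) / 3) := h1
      _ = (∫ x, ‖u x‖ ^ 6) ^ ((1 : ℝ) / 3) := by rw [h6]
      _ ≤ ((C₆ + 1) * Torus.gradNormSq u ^ 3) ^ ((1 : ℝ) / 3) := Real.rpow_le_rpow hJ6 h2 (by norm_num)
      _ = (C₆ + 1) ^ ((1 : ℝ) / 3) * Torus.gradNormSq u := by
          rw [Real.mul_rpow (by linarith) (pow_nonneg hG0 3), show Torus.gradNormSq u ^ 3 =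
            Torus.gradNormSq u ^ (3 : ℝ) by norm_cast, ← Real.rpow_mul hG0]
          norm_num
      _ ≤ (C₆ + 1) ^ ((1 : ℝ) / 3) * (72 * torusTopEigMoment q u ^ (2 / q)) :=
          mul_le_mul_of_nonneg_left hG (Real.rpow_nonneg (by linarith) _)
  -- assemble: `Φ_q^{2/q} · Φ_q^{(q−2)/q} = Φ_q`
  have hsum1 : 2 / q + (q - 2) / q = 1 := by field_simp; ring
  have hsplit : torusTopEigMoment q u ^ (2 / q) * torusTopEigMoment q u ^ ((q - 2) / q) =
      torusTopEigMoment q u := by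
    rw [← Real.rpow_add' hF0 (by rw [hsum1]; exact one_ne_zero), hsum1, Real.rpow_one]
  have hB0 : 0 ≤ torusTopEigMoment q u ^ ((q - 2) / q) := Real.rpow_nonneg hF0 _
  calc ∫ x, ‖u x‖ ^ 2 * torusStrainTopEig u x ^ (q - 2)
      ≤ (∫ x, ‖u x‖ ^ q) ^ (2 / q) * torusTopEigMoment q u ^ ((q - 2) / q) := hH
    _ ≤ (C₆ + 1) ^ ((1 : ℝ) / 3) * (72 * torusTopEigMoment q u ^ (2 / q)) *
          torusTopEigMoment q u ^ ((q - 2) / q) := mul_le_mul_of_nonneg_right hJ hB0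
    _ = 72 * (C₆ + 1) ^ ((1 : ℝ) / 3) *
          (torusTopEigMoment q u ^ (2 / q) * torusTopEigMoment q u ^ ((q - 2) / q)) := by ring
    _ = 72 * (C₆ + 1) ^ ((1 : ℝ) / 3) * torusTopEigMoment q u := by rw [hsplit]

end TopEig

end Summit.NavierStokesRegularity.FunctionalMining

end
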